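import Mathlib.Analysis.Normed.Module.FiniteDimension
import Mathlib.Analysis.SpecialFunctions.Pow.Real
import HarnessLib

/-!
# Pointwise decay of the powers of a linear map on a finite-dimensional space is geometric

Topic `Analysis/OperatorTheory`; namespace `Literature.Analysis.OperatorTheory`. Theorems only. The
elementary half of the spectral radius formula used to read DECAY RATES off linear recurrences
(for us: the Kirillov functions of a smooth vector of a `p`-adic representation of `GL₂` satisfy, for
`k` large, `G(k) = A^k s` with `A` the action of `diag(ϖ, 1)` on the finite-dimensional Jacquet module;
if every such sequence tends to `0` — Howe–Moore — then it decays geometrically with a rate depending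
only on `A`):

* `tendsto_opNorm_pow_zero_of_forall_tendsto` — on a finite-dimensional complex normed space, if
  `A^k x → 0` for every `x` then `‖A^k‖ → 0` (test on a basis, `Module.Basis.exists_opNorm_le`);
* `opNorm_pow_le_max_pow`, `opNorm_pow_le_pow` — `‖A^k‖ ≤ max ‖A‖ 1 ^ k`, `‖B^q‖ ≤ ‖B‖^q` (all exponents, including `0`);
* `exists_geometric_opNorm_pow_le_of_forall_tendsto` (**main**) — there are `C > 0` and `θ ∈ (0, 1)`
  with `‖A^k‖ ≤ C θ^k` for all `k` (choose `k₀ ≥ 1` with `‖A^{k₀}‖ ≤ 1/2`, write `k = q k₀ + r` and use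
  submultiplicativity; `θ = (1/2)^{1/k₀}`, `C = 2 (max ‖A‖ 1)^{k₀}`);
* `exists_geometric_norm_pow_apply_le_of_forall_tendsto` — hence `‖A^k x‖ ≤ C θ^k ‖x‖` uniformly in `x`.

Standard linear algebra (Horn–Johnson, *Matrix Analysis* (1985), Thm. 5.6.12: `A^k → 0` iff `ρ(A) < 1`,
with the bound `‖A^k‖ ≤ C θ^k`); proved here without spectral theory. [folklore]
-/

noncomputable section

open Filter
open scoped Topology

namespace Literature.Analysis.OperatorTheory

variable {E : Type*} [NormedAddCommGroup E] [NormedSpace ℂ E] [FiniteDimensional ℂ E]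

/-- **Pointwise convergence of powers to `0` is norm convergence, in finite dimension.** If
`A^k x → 0` for every `x` then `‖A^k‖ → 0` (bound the operator norm by the values on a basis).
[folklore] -/
theorem tendsto_opNorm_pow_zero_of_forall_tendsto (A : E →L[ℂ] E)
    (h : ∀ x : E, Tendsto (fun k : ℕ => (A ^ k) x) atTop (𝓝 0)) :
    Tendsto (fun k : ℕ => ‖A ^ k‖) atTop (𝓝 0) := by
  classical
  set b := Module.finBasis ℂ E with hb
  obtain ⟨C, hC, hbound⟩ := b.exists_opNorm_le (F := E)
  rw [Metric.tendsto_nhds]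
  intro ε hε
  have hε' : 0 < ε / (2 * C) := by positivity
  have hev : ∀ i, ∀ᶠ k in atTop, ‖(A ^ k) (b i)‖ ≤ ε / (2 * C) := fun i => by
    have := (Metric.tendsto_nhds.1 (h (b i))) (ε / (2 * C)) hε'
    filter_upwards [this] with k hk
    rw [dist_zero_right] at hk
    exact hk.le
  have hall : ∀ᶠ k in atTop, ∀ i, ‖(A ^ k) (b i)‖ ≤ ε / (2 * C) := eventually_all.2 hev
  filter_upwards [hall] with k hk
  rw [dist_zero_right, Real.norm_of_nonneg (norm_nonneg _)]
  calc ‖A ^ k‖ ≤ C * (ε / (2 * C)) := hbound hε'.le (fun i => hk i)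
    _ = ε / 2 := by field_simp
    _ < ε := half_lt_self hε

omit [FiniteDimensional ℂ E] in
/-- `‖A^k‖ ≤ (max ‖A‖ 1)^k` for every `k` (also `k = 0`, where `‖1‖ ≤ 1`). [folklore] -/
theorem opNorm_pow_le_max_pow (A : E →L[ℂ] E) (k : ℕ) : ‖A ^ k‖ ≤ max ‖A‖ 1 ^ k := by
  induction k with
  | zero =>
    rw [pow_zero, pow_zero]
    exact ContinuousLinearMap.norm_id_le
  | succ k ih =>
    rw [pow_succ, pow_succ]
    exact (norm_mul_le _ _).trans (mul_le_mul ih (le_max_left _ _) (norm_nonneg _) (by positivity))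

omit [FiniteDimensional ℂ E] in
/-- `‖B^q‖ ≤ ‖B‖^q` for every `q` (also `q = 0`, where `‖1‖ ≤ 1`). [folklore] -/
theorem opNorm_pow_le_pow (B : E →L[ℂ] E) (q : ℕ) : ‖B ^ q‖ ≤ ‖B‖ ^ q := by
  induction q with
  | zero =>
    rw [pow_zero, pow_zero]
    exact ContinuousLinearMap.norm_id_le
  | succ q ih =>
    rw [pow_succ, pow_succ]
    exact (norm_mul_le _ _).trans (mul_le_mul ih le_rfl (norm_nonneg _) (pow_nonneg (norm_nonneg _) _))

/-- **Pointwise decay of powers is geometric, in finite dimension**: if `A^k x → 0` for every `x`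
then `‖A^k‖ ≤ C θ^k` for some `C > 0`, `0 < θ < 1` and all `k`. Proof: `‖A^{k₀}‖ ≤ 1/2` for some
`k₀ ≥ 1` (`tendsto_opNorm_pow_zero_of_forall_tendsto`); for `k = q k₀ + r`, `r < k₀`,
`‖A^k‖ ≤ ‖A^{k₀}‖^q (max ‖A‖ 1)^r ≤ 2 (max ‖A‖ 1)^{k₀} θ^k` with `θ = (1/2)^{1/k₀}`.
(Horn–Johnson (1985), Thm. 5.6.12.) [folklore] -/
theorem exists_geometric_opNorm_pow_le_of_forall_tendsto (A : E →L[ℂ] E)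
    (h : ∀ x : E, Tendsto (fun k : ℕ => (A ^ k) x) atTop (𝓝 0)) :
    ∃ C θ : ℝ, 0 < C ∧ 0 < θ ∧ θ < 1 ∧ ∀ k : ℕ, ‖A ^ k‖ ≤ C * θ ^ k := by
  have ht := tendsto_opNorm_pow_zero_of_forall_tendsto A h
  -- `k₀ ≥ 1` with `‖A^{k₀}‖ ≤ 1/2`
  obtain ⟨k₀, hk₀1, hAk₀⟩ : ∃ k₀ : ℕ, 1 ≤ k₀ ∧ ‖A ^ k₀‖ ≤ 1 / 2 := by
    have hev : ∀ᶠ k in atTop, ‖A ^ k‖ ≤ 1 / 2 := by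
      have := (Metric.tendsto_nhds.1 ht) (1 / 2) (by norm_num)
      filter_upwards [this] with k hk
      rw [dist_zero_right, Real.norm_of_nonneg (norm_nonneg _)] at hk
      exact hk.le
    obtain ⟨k₀, hk₀⟩ := (hev.and (eventually_ge_atTop 1)).exists
    exact ⟨k₀, hk₀.2, hk₀.1⟩
  have hk₀0 : (k₀ : ℝ) ≠ 0 := by exact_mod_cast (by omega : k₀ ≠ 0)
  -- constants
  set M : ℝ := max ‖A‖ 1 with hM
  have hM1 : 1 ≤ M := le_max_right _ _
  set θ : ℝ := (1 / 2 : ℝ) ^ ((1 : ℝ) / k₀) with hθ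
  have hθ0 : 0 < θ := Real.rpow_pos_of_pos (by norm_num) _
  have hθ1 : θ < 1 := Real.rpow_lt_one (by norm_num) (by norm_num) (by positivity)
  have hθk₀ : θ ^ k₀ = 1 / 2 := by
    rw [hθ, ← Real.rpow_natCast, ← Real.rpow_mul (by norm_num), one_div_mul_cancel hk₀0, Real.rpow_one]
  refine ⟨2 * M ^ k₀, θ, by positivity, hθ0, hθ1, fun k => ?_⟩
  -- `k = q k₀ + r`
  set q := k / k₀ with hq
  set r := k % k₀ with hr
  have hk : k = q * k₀ + r := by rw [hq, hr, Nat.mul_comm, Nat.div_add_mod]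
  have hrk₀ : r < k₀ := Nat.mod_lt _ (by omega)
  -- `‖A^k‖ ≤ (1/2)^q M^r`
  have h1 : ‖A ^ k‖ ≤ (1 / 2) ^ q * M ^ r := by
    rw [hk, pow_add, pow_mul']
    refine (norm_mul_le _ _).trans (mul_le_mul ?_ (opNorm_pow_le_max_pow A r) (norm_nonneg _) (by positivity))
    exact (opNorm_pow_le_pow (A ^ k₀) q).trans
      (pow_le_pow_left₀ (norm_nonneg _) hAk₀ q)
  -- `(1/2)^q = θ^(q k₀) = θ^k / θ^r ≤ θ^k / θ^k₀ = 2 θ^k`, and `M^r ≤ M^k₀`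
  have h2 : (1 / 2 : ℝ) ^ q * M ^ r ≤ 2 * M ^ k₀ * θ ^ k := by
    have hq2 : (1 / 2 : ℝ) ^ q = θ ^ (q * k₀) := by rw [pow_mul', hθk₀]
    have hMr : M ^ r ≤ M ^ k₀ := pow_le_pow_right₀ hM1 hrk₀.le
    have hθr : θ ^ k ≥ θ ^ (q * k₀) * θ ^ k₀ := by
      rw [← pow_add]
      exact pow_le_pow_of_le_one hθ0.le hθ1.le (by rw [hk]; omega)
    calc (1 / 2 : ℝ) ^ q * M ^ r = θ ^ (q * k₀) * M ^ r := by rw [hq2]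
      _ ≤ θ ^ (q * k₀) * M ^ k₀ := by gcongr
      _ = (θ ^ (q * k₀) * θ ^ k₀) * (2 * M ^ k₀) := by rw [hθk₀]; ring
      _ ≤ θ ^ k * (2 * M ^ k₀) := by gcongr
      _ = 2 * M ^ k₀ * θ ^ k := by ring
  exact h1.trans h2

/-- **Uniform geometric decay of the orbits**: under the same hypothesis,
`‖A^k x‖ ≤ C θ^k ‖x‖` for all `k` and `x`, with `C > 0`, `0 < θ < 1` independent of `x`. [folklore] -/
theorem exists_geometric_norm_pow_apply_le_of_forall_tendsto (A : E →L[ℂ] E)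
    (h : ∀ x : E, Tendsto (fun k : ℕ => (A ^ k) x) atTop (𝓝 0)) :
    ∃ C θ : ℝ, 0 < C ∧ 0 < θ ∧ θ < 1 ∧ ∀ (k : ℕ) (x : E), ‖(A ^ k) x‖ ≤ C * θ ^ k * ‖x‖ := by
  obtain ⟨C, θ, hC, hθ0, hθ1, hk⟩ := exists_geometric_opNorm_pow_le_of_forall_tendsto A h
  exact ⟨C, θ, hC, hθ0, hθ1, fun k x => ((A ^ k).le_opNorm x).trans
    (mul_le_mul_of_nonneg_right (hk k) (norm_nonneg _))⟩

/-- **Square-summability of the decaying orbits**: `Σ_k ‖A^k x‖² < ∞`, with a bound uniform on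
bounded sets of `x`. [folklore] -/
theorem summable_norm_pow_apply_sq_of_forall_tendsto (A : E →L[ℂ] E)
    (h : ∀ x : E, Tendsto (fun k : ℕ => (A ^ k) x) atTop (𝓝 0)) (x : E) :
    Summable fun k : ℕ => ‖(A ^ k) x‖ ^ 2 := by
  obtain ⟨C, θ, hC, hθ0, hθ1, hk⟩ := exists_geometric_norm_pow_apply_le_of_forall_tendsto A h
  have hgeom : Summable fun k : ℕ => (C * ‖x‖) ^ 2 * (θ ^ 2) ^ k :=
    (summable_geometric_of_lt_one (by positivity) (by nlinarith)).mul_left _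
  refine Summable.of_nonneg_of_le (fun k => by positivity) (fun k => ?_) hgeom
  have hle : ‖(A ^ k) x‖ ≤ C * ‖x‖ * θ ^ k := by
    have := hk k x
    nlinarith [this]
  calc ‖(A ^ k) x‖ ^ 2 ≤ (C * ‖x‖ * θ ^ k) ^ 2 := pow_le_pow_left₀ (norm_nonneg _) hle 2
    _ = (C * ‖x‖) ^ 2 * (θ ^ 2) ^ k := by ring

end Literature.Analysis.OperatorTheory
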